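import Mathlib
import Literature.NumberTheory.LFunctions.Zhang2022.SkeletonPartTwo
import HarnessLib

/-!
# Zhang (2022), Appendix A part 1 (proof of Lemma 8.3): the local factors of `ξ₀ⱼ` at prime
# powers (Cases 1–3) and the product identities for `λ`, `λ̃`, `κ̃` — kernel-checked

Topic `Literature/NumberTheory/LFunctions/Zhang2022` (Landau–Siegel audit tree; verdict-neutral).
Y. Zhang, *Discrete mean estimates and the Landau–Siegel zero*, arXiv:2211.02515v1 (2022)
[Zhang2022LandauSiegel], Appendix A pp. 101–103 (tex L4975–L5083), **an unrefereed manuscript under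
adjudication**. This file PROVES the exact (error-free) arithmetic identities that the printed proof
of Lemma 8.3 states or uses without proof, for the banked objects of `SkeletonMeanValue`
(`Skeleton.kappaZ = κ`, `Skeleton.kappaTilde = κ̃(d;m,s)`, `Skeleton.nset = 𝔫(d)`, `Skeleton.lam = λ`,
`Skeleton.lamZero = λ₀ⱼ`, `Skeleton.lamTildeZero = λ̃₀ⱼ`, the inner sum of `Skeleton.xiZero = ξ₀ⱼ`):

* `mem_nset_one_iff`, `eq_prime_pow_of_mem_nset`, `prime_pow_mem_nset` — `𝔫(1) = {1}` and `𝔫(q^e) = {q^i}`;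
* `tsum_nset_prime_pow_of_dvd` / `_of_not_dvd` — a series `Σ_{h ∈ 𝔫(q^e), (h,M)=1} F(h)` is `F(1)`
  if `q ∣ M` and `Σ_i F(q^i)` if `q ∤ M` (DAG `Z22:§A.u010` "because", tex L5032);
* `kappaTilde_prime_pow_of_dvd`: **`κ̃(q^e; M, s) = κ(q^e)` if `q ∣ M`**; `kappaTilde_prime_pow_of_not_dvd`:
  `κ̃(q^e; M, s) = Σ_i κ(q^{e+i}) (q^i)^{−s}` if `q ∤ M`, `e ≥ 1`;
* `lamTildeZero_prime_pow`: `λ̃₀ⱼ(q^e, M) = λ₀ⱼ(q)` if `(q,M) = 1`, `= 1` otherwise (tex L5068, L5076);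
* `lam_mul_eq` (**Z22:§A.u002**, tex L4976): `λ(km,s) = λ(k,s)·∏_{q∣m,(q,k)=1}(…)`, and
  `prod_primeFactors_filter_prime_pow` (tex L4982): the `λ̃`-product of `q^r` is that of `q`;
* the inner sum `Ξ(m;d,r) = Σ_{m=d₁k,(k,r)=1} κ̃₀ⱼ(d₁;drk)μ(k)k^{1−β_j}/φ(k)` of `ξ₀ⱼ` at `m = q^e`
  (`innerSum_prime_pow…`, `xiZero_prime_pow…`; no new definitions):
  **Case 2** (`q ∣ r`, tex L5062) `Ξ(q^e) = κ(q^e)`; **Case 3** (`q ∣ d`, `q ∤ r`, tex L5077)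
  `Ξ(q^e) = κ(q^e) − κ(q^{e−1})q^{1−β_j}/(q−1)` (the manuscript prints `q/(q−1)`: the factor `q^{−β_j}`
  is dropped in print, flag F6 of `TypedAppendixA1`); **Case 1** (`q ∤ dr`, tex L5029)
  `Ξ(q^e) = κ̃₀ⱼ(q^e;dr) − κ(q^{e−1})q^{1−β_j}/(q−1)` with `κ̃₀ⱼ(q^e;dr) = Σ_i κ(q^{e+i})q^{−i(1−β_j)}`.

All statements are exact identities (no Assumption (A), no `D`-largeness); they are the
`rfl`-level inputs of the campaign's typed nodes `Typed.AppendixA1.StepA_u002/u004_pow/u010/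
u010_because/u016_eq/u017_lamTilde/u018_lamTilde` (bridged in a companion file once that module is
built). Nothing here bears on Theorems 1–2 of the manuscript.

## References

* Y. Zhang, arXiv:2211.02515v1 (2022), Appendix A pp. 101–103; §7 p. 33 (the objects).
  [cite: Zhang2022LandauSiegel, App. A]
-/

noncomputable section

open Complex Real ComplexConjugate ArithmeticFunction

namespace Literature.NumberTheory.LFunctions.Zhang2022.Lemma83

open Literature.NumberTheory.LFunctions.Zhang2022.Skeleton

/-! ## `𝔫(1)` and `𝔫(q^e)` -/

/-- `𝔫(1) = {1}`: a positive integer all of whose prime factors divide `1` is `1`.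
[cite: Zhang2022LandauSiegel, §7 p. 33] -/
theorem mem_nset_one_iff {h : ℕ} : h ∈ nset 1 ↔ h = 1 := by
  constructor
  · rintro ⟨hpos, hdiv⟩
    by_contra hne
    obtain ⟨p, hp, hph⟩ := Nat.exists_prime_and_dvd hne
    exact hp.ne_one (Nat.dvd_one.mp (hdiv p hp hph))
  · rintro rfl
    exact ⟨one_pos, fun p hp hp1 => hp1⟩

/-- If `h ∈ 𝔫(q^e)` (`q` prime) and `h ≠ 1` then `q ∣ h`. [cite: Zhang2022LandauSiegel, §7 p. 33] -/
theorem dvd_of_mem_nset_prime_pow {q e h : ℕ} (hq : q.Prime) (hh : h ∈ nset (q ^ e)) (h1 : h ≠ 1) :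
    q ∣ h := by
  obtain ⟨p, hp, hph⟩ := Nat.exists_prime_and_dvd h1
  have hpq : p ∣ q := hp.dvd_of_dvd_pow (hh.2 p hp hph)
  rwa [(Nat.prime_dvd_prime_iff_eq hp hq).mp hpq] at hph

/-- Every element of `𝔫(q^e)` (`q` prime) is a power of `q`. [cite: Zhang2022LandauSiegel, §7 p. 33] -/
theorem eq_prime_pow_of_mem_nset {q e h : ℕ} (hq : q.Prime) (hh : h ∈ nset (q ^ e)) :
    ∃ i : ℕ, h = q ^ i := by
  refine ⟨h.primeFactorsList.length, Nat.eq_prime_pow_of_unique_prime_dvd hh.1.ne' ?_⟩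
  intro p hp hph
  exact (Nat.prime_dvd_prime_iff_eq hp hq).mp (hp.dvd_of_dvd_pow (hh.2 p hp hph))

/-- Powers of `q` lie in `𝔫(q^e)` for `e ≥ 1`. [cite: Zhang2022LandauSiegel, §7 p. 33] -/
theorem prime_pow_mem_nset {q e : ℕ} (hq : q.Prime) (he : e ≠ 0) (i : ℕ) : q ^ i ∈ nset (q ^ e) := by
  refine ⟨pow_pos hq.pos i, fun p hp hpi => ?_⟩
  have hpq : p ∣ q := hp.dvd_of_dvd_pow hpi
  exact hpq.trans (dvd_pow_self q he)

/-! ## Series over `h ∈ 𝔫(q^e)`, `(h,M) = 1` -/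

open scoped Classical in
/-- If `q ∣ M`, a series over `h ∈ 𝔫(q^e)` with `(h,M) = 1` has the single term `h = 1` (the only
element of `𝔫(q^e)` coprime to `M`): `Σ_{h∈𝔫(q^e),(h,M)=1} F(h) = F(1)`. This is the mechanism of
"`κ̃(q^{r−1};dq,1−β_j) = κ(q^{r−1})`" (App. A p. 102, tex L5032). [cite: Zhang2022LandauSiegel, App. A p. 102] -/
theorem tsum_nset_prime_pow_of_dvd {q e M : ℕ} (hq : q.Prime) (hM : q ∣ M) (F : ℕ → ℂ) :
    ∑' h : ℕ, (if h ∈ nset (q ^ e) ∧ Nat.Coprime h M then F h else 0) = F 1 := by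
  rw [tsum_eq_single 1]
  · have h1 : (1 : ℕ) ∈ nset (q ^ e) ∧ Nat.Coprime 1 M :=
      ⟨⟨one_pos, fun p hp hp1 => absurd (Nat.dvd_one.mp hp1) hp.ne_one⟩, Nat.coprime_one_left M⟩
    rw [if_pos h1]
  · intro h hne
    rw [if_neg]
    rintro ⟨hmem, hcop⟩
    have hqh : q ∣ h := dvd_of_mem_nset_prime_pow hq hmem hne
    have hq1 : q ∣ Nat.gcd h M := Nat.dvd_gcd hqh hM
    rw [hcop] at hq1
    exact hq.ne_one (Nat.dvd_one.mp hq1)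

open scoped Classical in
/-- If `q ∤ M` and `e ≥ 1`, a series over `h ∈ 𝔫(q^e)` with `(h,M) = 1` is the series over the powers
`h = q^i`: `Σ_{h∈𝔫(q^e),(h,M)=1} F(h) = Σ_{i≥0} F(q^i)`. [cite: Zhang2022LandauSiegel, App. A p. 102] -/
theorem tsum_nset_prime_pow_of_not_dvd {q e M : ℕ} (hq : q.Prime) (he : e ≠ 0) (hM : ¬ q ∣ M)
    (F : ℕ → ℂ) :
    ∑' h : ℕ, (if h ∈ nset (q ^ e) ∧ Nat.Coprime h M then F h else 0) = ∑' i : ℕ, F (q ^ i) := by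
  set f : ℕ → ℂ := fun h => if h ∈ nset (q ^ e) ∧ Nat.Coprime h M then F h else 0 with hf
  have hinj : Function.Injective (fun i : ℕ => q ^ i) := Nat.pow_right_injective hq.two_le
  have hsupp : Function.support f ⊆ Set.range (fun i : ℕ => q ^ i) := by
    intro h hh
    rw [Function.mem_support] at hh
    have hmem : h ∈ nset (q ^ e) ∧ Nat.Coprime h M := by
      by_contra hnot
      exact hh (by rw [hf]; exact if_neg hnot)
    obtain ⟨i, hi⟩ := eq_prime_pow_of_mem_nset hq hmem.1
    exact ⟨i, hi.symm⟩
  rw [← hinj.tsum_eq hsupp]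
  refine tsum_congr fun i => ?_
  have hcop : Nat.Coprime (q ^ i) M :=
    Nat.Coprime.pow_left i ((Nat.Prime.coprime_iff_not_dvd hq).mpr hM)
  simp only [hf]
  rw [if_pos ⟨prime_pow_mem_nset hq he i, hcop⟩]

/-! ## `κ̃` and `λ̃₀ⱼ` at prime powers -/

/-- `κ(1) = 1` (`κ` is multiplicative). [cite: Zhang2022LandauSiegel, §7 p. 33] -/
theorem kappaZ_one (c' : ℝ) (D : ℕ) : kappaZ c' D 1 = 1 :=
  (MeanSquareMajorant.isMultiplicative_kappa _ _ _).map_one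

/-- **`κ̃(q^e; M, s) = κ(q^e)` when `q ∣ M`** (`q` prime, any `e`, any `s`): the only `h ∈ 𝔫(q^e)`
coprime to `M` is `h = 1`. In particular `κ̃(q^{r−1}; dq, 1−β_j) = κ(q^{r−1})` (App. A p. 102,
tex L5032) and `κ̃₀ⱼ(q^e; dr) = κ(q^e)` whenever `q ∣ dr` (Cases 2–3).
[cite: Zhang2022LandauSiegel, App. A p. 102] -/
theorem kappaTilde_prime_pow_of_dvd (c' : ℝ) (D : ℕ) {q M : ℕ} (hq : q.Prime) (hM : q ∣ M)
    (e : ℕ) (s : ℂ) : kappaTilde c' D (q ^ e) M s = kappaZ c' D (q ^ e) := by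
  unfold kappaTilde
  rw [tsum_nset_prime_pow_of_dvd hq hM]
  simp

/-- **`κ̃(q^e; M, s) = Σ_{i≥0} κ(q^{e+i}) (q^i)^{−s}` when `q ∤ M`**, `e ≥ 1` (`q` prime): the elements of
`𝔫(q^e)` are the powers `q^i`, all coprime to `M` (Case 1, App. A p. 102).
[cite: Zhang2022LandauSiegel, App. A p. 102] -/
theorem kappaTilde_prime_pow_of_not_dvd (c' : ℝ) (D : ℕ) {q e M : ℕ} (hq : q.Prime) (he : e ≠ 0)
    (hM : ¬ q ∣ M) (s : ℂ) :
    kappaTilde c' D (q ^ e) M s = ∑' i : ℕ, kappaZ c' D (q ^ (e + i)) / ((q ^ i : ℕ) : ℂ) ^ s := by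
  unfold kappaTilde
  rw [tsum_nset_prime_pow_of_not_dvd hq he hM]
  refine tsum_congr fun i => ?_
  rw [pow_add]

/-- `λ̃₀ⱼ(q^e, M)` for a prime power (`e ≥ 1`): `λ₀ⱼ(q)` if `(q,M) = 1`, and `1` (empty product) if
`q ∣ M` — "since `λ̃(q,dh;1−β_j) = 1`" in Cases 2 and 3 (App. A p. 103, tex L5068, L5076).
[cite: Zhang2022LandauSiegel, App. A p. 103] -/
theorem lamTildeZero_prime_pow (c' : ℝ) (D : ℕ) {q e : ℕ} (hq : q.Prime) (he : e ≠ 0) (j M : ℕ) :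
    lamTildeZero c' D j (q ^ e) M = if Nat.Coprime q M then lamZero c' D j q else 1 := by
  unfold lamTildeZero
  rw [Nat.primeFactors_prime_pow he hq]
  by_cases hc : Nat.Coprime q M
  · rw [if_pos hc, Finset.filter_singleton, if_pos hc, Finset.prod_singleton]
  · rw [if_neg hc, Finset.filter_singleton, if_neg hc, Finset.prod_empty]

/-! ## `λ(km,s) = λ(k,s)λ̃(m,k;s)` (Z22:§A.u002) and `λ̃(q^r,k;s) = λ̃(q,k;s)` -/

/-- **Z22:§A.u002** (App. A p. 101, tex L4976): "`λ(km,s) = λ(k,s)λ̃(m,k;s)`" with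
`λ̃(m,k;s) = ∏_{q∣m,(q,k)=1}` of the factors of `λ` — the prime factors of `km` are those of `k`
together with those of `m` prime to `k`, disjointly (`k, m ≥ 1`). Exact identity.
[cite: Zhang2022LandauSiegel, App. A p. 101] -/
theorem lam_mul_eq (c' : ℝ) (D : ℕ) {k m : ℕ} (hk : k ≠ 0) (hm : m ≠ 0) (s : ℂ) :
    lam c' D (k * m) s = lam c' D k s *
      ∏ q ∈ m.primeFactors.filter (fun q => Nat.Coprime q k),
        (1 - (q : ℂ) ^ (-(s + beta1 c' D))) * (1 - (q : ℂ) ^ (-(s + beta2 c' D))) *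
          (1 - (q : ℂ) ^ (-(s + beta3 c' D))) / (1 - (q : ℂ) ^ (-s)) := by
  unfold lam
  have hunion : (k * m).primeFactors =
      k.primeFactors ∪ m.primeFactors.filter (fun q => Nat.Coprime q k) := by
    rw [Nat.primeFactors_mul hk hm]
    ext q
    simp only [Finset.mem_union, Finset.mem_filter]
    constructor
    · rintro (hqk | hqm)
      · exact Or.inl hqk
      · by_cases hc : Nat.Coprime q k
        · exact Or.inr ⟨hqm, hc⟩
        · left
          have hqp : q.Prime := Nat.prime_of_mem_primeFactors hqm
          have hqdk : q ∣ k := by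
            by_contra hnd
            exact hc ((Nat.Prime.coprime_iff_not_dvd hqp).mpr hnd)
          exact Nat.mem_primeFactors.mpr ⟨hqp, hqdk, hk⟩
    · rintro (hqk | ⟨hqm, _⟩)
      · exact Or.inl hqk
      · exact Or.inr hqm
  have hdisj : Disjoint k.primeFactors (m.primeFactors.filter (fun q => Nat.Coprime q k)) := by
    rw [Finset.disjoint_left]
    intro q hqk hqf
    rw [Finset.mem_filter] at hqf
    have hqp : q.Prime := Nat.prime_of_mem_primeFactors hqk
    have hqdk : q ∣ k := Nat.dvd_of_mem_primeFactors hqk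
    exact ((Nat.Prime.coprime_iff_not_dvd hqp).mp hqf.2) hqdk
  rw [hunion, Finset.prod_union hdisj]

/-- "`λ̃(q^r,k;s) = λ̃(q,k;s)` for any `r`" (`r ≥ 1`; App. A p. 101, tex L4982): the `λ̃`-product only
sees the set of prime factors. Stated for an arbitrary factor function `g`.
[cite: Zhang2022LandauSiegel, App. A p. 101] -/
theorem prod_primeFactors_filter_prime_pow (q : ℕ) {r : ℕ} (hr : r ≠ 0) (k : ℕ)
    (g : ℕ → ℂ) :
    ∏ p ∈ (q ^ r).primeFactors.filter (fun p => Nat.Coprime p k), g p =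
      ∏ p ∈ q.primeFactors.filter (fun p => Nat.Coprime p k), g p := by
  rw [Nat.primeFactors_pow q hr]

/-! ## The inner sum of `ξ₀ⱼ` at a prime power: Cases 1–3 -/

section InnerSum

variable (c' : ℝ) (D : ℕ) (j : ℕ)

/-- The inner sum `Σ_{m=d₁k,(k,r)=1} κ̃₀ⱼ(d₁;drk)μ(k)k^{1−β_j}/φ(k)` of `ξ₀ⱼ(m;d,r)` (§7 p. 33; the
`ξ_j(m;d,r)` of Appendix A) at a prime power `m = q^e`, `e ≥ 1`: only the squarefree divisors
`k = 1` and (when `(q,r) = 1`) `k = q` contribute, with `μ(1) = 1`, `μ(q) = −1`, `φ(q) = q − 1`: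
`= κ̃₀ⱼ(q^e;dr) − [q ∤ r]·κ̃₀ⱼ(q^{e−1};drq)·q^{1−β_j}/(q−1)`.
[cite: Zhang2022LandauSiegel, App. A p. 102] -/
theorem innerSum_prime_pow {q e : ℕ} (hq : q.Prime) (he : e ≠ 0) (d r : ℕ) :
    (∑ k ∈ (q ^ e).divisors.filter (fun k => Nat.Coprime k r),
      kappaTildeZero c' D j (q ^ e / k) (d * r * k) * (ArithmeticFunction.moebius k : ℂ) *
        (k : ℂ) ^ (1 - betaJ c' D j) / (Nat.totient k : ℂ)) =
    kappaTildeZero c' D j (q ^ e) (d * r) -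
      (if Nat.Coprime q r then
        kappaTildeZero c' D j (q ^ (e - 1)) (d * r * q) * (q : ℂ) ^ (1 - betaJ c' D j) / ((q : ℂ) - 1)
       else 0) := by
  rw [Finset.sum_filter, Nat.sum_divisors_prime_pow hq]
  obtain ⟨e', rfl⟩ : ∃ e', e = e' + 1 := ⟨e - 1, (Nat.succ_pred_eq_of_ne_zero he).symm⟩
  rw [Finset.sum_range_succ', Finset.sum_range_succ']
  -- the terms with `k = q^{i+2}` vanish (`μ = 0`)
  have hzero : ∑ i ∈ Finset.range e', (if Nat.Coprime (q ^ (i + 1 + 1)) r then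
      kappaTildeZero c' D j (q ^ (e' + 1) / q ^ (i + 1 + 1)) (d * r * q ^ (i + 1 + 1)) *
        (ArithmeticFunction.moebius (q ^ (i + 1 + 1)) : ℂ) *
          ((q ^ (i + 1 + 1) : ℕ) : ℂ) ^ (1 - betaJ c' D j) / (Nat.totient (q ^ (i + 1 + 1)) : ℂ)
      else 0) = 0 := by
    refine Finset.sum_eq_zero fun i _ => ?_
    have hμ : ArithmeticFunction.moebius (q ^ (i + 1 + 1)) = 0 := by
      rw [ArithmeticFunction.moebius_apply_prime_pow hq (by omega), if_neg (by omega)]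
    simp [hμ]
  rw [hzero, zero_add]
  -- the term `k = 1`
  have hk1 : (if Nat.Coprime (q ^ 0) r then
      kappaTildeZero c' D j (q ^ (e' + 1) / q ^ 0) (d * r * q ^ 0) *
        (ArithmeticFunction.moebius (q ^ 0) : ℂ) * ((q ^ 0 : ℕ) : ℂ) ^ (1 - betaJ c' D j) /
          (Nat.totient (q ^ 0) : ℂ) else 0) = kappaTildeZero c' D j (q ^ (e' + 1)) (d * r) := by
    rw [if_pos (by simp)]
    simp
  rw [hk1]
  -- the term `k = q`
  have hdiv : q ^ (e' + 1) / q ^ (0 + 1) = q ^ (e' + 1 - 1) := by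
    rw [zero_add, pow_one, Nat.add_sub_cancel, pow_succ, Nat.mul_div_cancel _ hq.pos]
  have htot : (Nat.totient (q ^ (0 + 1)) : ℂ) = (q : ℂ) - 1 := by
    rw [zero_add, pow_one, Nat.totient_prime hq, Nat.cast_sub hq.one_le, Nat.cast_one]
  have hμq : (ArithmeticFunction.moebius (q ^ (0 + 1)) : ℂ) = -1 := by
    rw [zero_add, pow_one, ArithmeticFunction.moebius_apply_prime hq]; norm_num
  by_cases hc : Nat.Coprime q r
  · have hc' : Nat.Coprime (q ^ (0 + 1)) r := by rw [zero_add, pow_one]; exact hc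
    rw [if_pos hc', if_pos hc, hdiv, htot, hμq]
    simp only [zero_add, pow_one]
    ring
  · have hc' : ¬ Nat.Coprime (q ^ (0 + 1)) r := by rw [zero_add, pow_one]; exact hc
    rw [if_neg hc', if_neg hc]
    ring

/-- **Case 2** (`q ∣ r`; App. A p. 102, tex L5062): "`ξ_j(q^r,dh) = κ(q^r)`" — the inner sum of
`ξ₀ⱼ(q^e;d,r)` is `κ(q^e)` for `e ≥ 1`. Exact. [cite: Zhang2022LandauSiegel, App. A p. 102] -/
theorem innerSum_prime_pow_of_dvd_right {q e : ℕ} (hq : q.Prime) (he : e ≠ 0) {d r : ℕ}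
    (hqr : q ∣ r) :
    (∑ k ∈ (q ^ e).divisors.filter (fun k => Nat.Coprime k r),
      kappaTildeZero c' D j (q ^ e / k) (d * r * k) * (ArithmeticFunction.moebius k : ℂ) *
        (k : ℂ) ^ (1 - betaJ c' D j) / (Nat.totient k : ℂ)) = kappaZ c' D (q ^ e) := by
  rw [innerSum_prime_pow c' D j hq he]
  have hnc : ¬ Nat.Coprime q r := fun hc => ((Nat.Prime.coprime_iff_not_dvd hq).mp hc) hqr
  rw [if_neg hnc, sub_zero, kappaTildeZero,
    kappaTilde_prime_pow_of_dvd c' D hq (dvd_mul_of_dvd_right hqr d)]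

/-- **Case 3** (`q ∣ d`, `q ∤ r`; App. A p. 103, tex L5077), EXACT form: the inner sum of
`ξ₀ⱼ(q^e;d,r)` is `κ(q^e) − κ(q^{e−1})·q^{1−β_j}/(q−1)` for `e ≥ 1` (the printed display has
`q/(q−1)`, dropping the unimodular factor `q^{−β_j}`; flag F6 of `TypedAppendixA1`).
[cite: Zhang2022LandauSiegel, App. A p. 103] -/
theorem innerSum_prime_pow_of_dvd_left {q e : ℕ} (hq : q.Prime) (he : e ≠ 0) {d r : ℕ}
    (hqd : q ∣ d) (hqr : ¬ q ∣ r) :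
    (∑ k ∈ (q ^ e).divisors.filter (fun k => Nat.Coprime k r),
      kappaTildeZero c' D j (q ^ e / k) (d * r * k) * (ArithmeticFunction.moebius k : ℂ) *
        (k : ℂ) ^ (1 - betaJ c' D j) / (Nat.totient k : ℂ)) =
      kappaZ c' D (q ^ e) - kappaZ c' D (q ^ (e - 1)) * (q : ℂ) ^ (1 - betaJ c' D j) / ((q : ℂ) - 1) := by
  rw [innerSum_prime_pow c' D j hq he, if_pos ((Nat.Prime.coprime_iff_not_dvd hq).mpr hqr),
    kappaTildeZero, kappaTildeZero,
    kappaTilde_prime_pow_of_dvd c' D hq (dvd_mul_of_dvd_left hqd r),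
    kappaTilde_prime_pow_of_dvd c' D hq (dvd_mul_left q (d * r))]

/-- **Case 1** (`q ∤ r`; App. A p. 102, tex L5029): "`ξ_j(q^r,dh) = κ̃(q^r;dh,1−β_j) −
κ(q^{r−1})q^{1−β_j}/(q−1)`" — the inner sum of `ξ₀ⱼ(q^e;d,r)` is `κ̃₀ⱼ(q^e;dr) −
κ(q^{e−1})q^{1−β_j}/(q−1)` for `e ≥ 1` (the text assumes also `q ∤ d`, which this identity does not
need). Exact. [cite: Zhang2022LandauSiegel, App. A p. 102] -/
theorem innerSum_prime_pow_of_not_dvd_right {q e : ℕ} (hq : q.Prime) (he : e ≠ 0) {d r : ℕ}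
    (hqr : ¬ q ∣ r) :
    (∑ k ∈ (q ^ e).divisors.filter (fun k => Nat.Coprime k r),
      kappaTildeZero c' D j (q ^ e / k) (d * r * k) * (ArithmeticFunction.moebius k : ℂ) *
        (k : ℂ) ^ (1 - betaJ c' D j) / (Nat.totient k : ℂ)) =
      kappaTildeZero c' D j (q ^ e) (d * r) -
        kappaZ c' D (q ^ (e - 1)) * (q : ℂ) ^ (1 - betaJ c' D j) / ((q : ℂ) - 1) := by
  rw [innerSum_prime_pow c' D j hq he, if_pos ((Nat.Prime.coprime_iff_not_dvd hq).mpr hqr),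
    kappaTildeZero, kappaTildeZero, kappaTilde_prime_pow_of_dvd c' D hq (dvd_mul_left q (d * r))]

/-- Case 1, continued: for `q ∤ dr` the series `κ̃₀ⱼ(q^e;dr)` is `Σ_i κ(q^{e+i}) (q^i)^{−(1−β_j)}`
(`e ≥ 1`). [cite: Zhang2022LandauSiegel, App. A p. 102] -/
theorem kappaTildeZero_prime_pow_of_coprime {q e : ℕ} (hq : q.Prime) (he : e ≠ 0) {d r : ℕ}
    (hqd : ¬ q ∣ d) (hqr : ¬ q ∣ r) :
    kappaTildeZero c' D j (q ^ e) (d * r) =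
      ∑' i : ℕ, kappaZ c' D (q ^ (e + i)) / ((q ^ i : ℕ) : ℂ) ^ (1 - betaJ c' D j) := by
  have hqdr : ¬ q ∣ d * r := fun h => (hq.dvd_mul.mp h).elim hqd hqr
  rw [kappaTildeZero, kappaTilde_prime_pow_of_not_dvd c' D hq he hqdr]

/-- `ξ₀ⱼ` at a prime power, Case 2 (`q ∣ r`): `ξ₀ⱼ(q^e;d,r) = κ(q^e)` (`λ̃₀ⱼ(q^e,dr) = 1`).
[cite: Zhang2022LandauSiegel, App. A p. 102] -/
theorem xiZero_prime_pow_of_dvd_right {q e : ℕ} (hq : q.Prime) (he : e ≠ 0) {d r : ℕ}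
    (hqr : q ∣ r) : xiZero c' D j (q ^ e) d r = kappaZ c' D (q ^ e) := by
  have hnc : ¬ Nat.Coprime q (d * r) := fun hc =>
    ((Nat.Prime.coprime_iff_not_dvd hq).mp hc) (dvd_mul_of_dvd_right hqr d)
  unfold xiZero
  rw [lamTildeZero_prime_pow c' D hq he, if_neg hnc, one_mul,
    innerSum_prime_pow_of_dvd_right c' D j hq he hqr]

/-- `ξ₀ⱼ` at a prime power, Case 3 (`q ∣ d`, `q ∤ r`):
`ξ₀ⱼ(q^e;d,r) = κ(q^e) − κ(q^{e−1})q^{1−β_j}/(q−1)`. [cite: Zhang2022LandauSiegel, App. A p. 103] -/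
theorem xiZero_prime_pow_of_dvd_left {q e : ℕ} (hq : q.Prime) (he : e ≠ 0) {d r : ℕ}
    (hqd : q ∣ d) (hqr : ¬ q ∣ r) :
    xiZero c' D j (q ^ e) d r =
      kappaZ c' D (q ^ e) - kappaZ c' D (q ^ (e - 1)) * (q : ℂ) ^ (1 - betaJ c' D j) / ((q : ℂ) - 1) := by
  have hnc : ¬ Nat.Coprime q (d * r) := fun hc =>
    ((Nat.Prime.coprime_iff_not_dvd hq).mp hc) (dvd_mul_of_dvd_left hqd r)
  unfold xiZero
  rw [lamTildeZero_prime_pow c' D hq he, if_neg hnc, one_mul,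
    innerSum_prime_pow_of_dvd_left c' D j hq he hqd hqr]

/-- `ξ₀ⱼ` at a prime power, Case 1 (`q ∤ dr`):
`ξ₀ⱼ(q^e;d,r) = λ₀ⱼ(q)·(Σ_i κ(q^{e+i})q^{−i(1−β_j)} − κ(q^{e−1})q^{1−β_j}/(q−1))`.
[cite: Zhang2022LandauSiegel, App. A p. 102] -/
theorem xiZero_prime_pow_of_coprime {q e : ℕ} (hq : q.Prime) (he : e ≠ 0) {d r : ℕ}
    (hqd : ¬ q ∣ d) (hqr : ¬ q ∣ r) :
    xiZero c' D j (q ^ e) d r = lamZero c' D j q *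
      ((∑' i : ℕ, kappaZ c' D (q ^ (e + i)) / ((q ^ i : ℕ) : ℂ) ^ (1 - betaJ c' D j)) -
        kappaZ c' D (q ^ (e - 1)) * (q : ℂ) ^ (1 - betaJ c' D j) / ((q : ℂ) - 1)) := by
  have hqdr : ¬ q ∣ d * r := fun h => (hq.dvd_mul.mp h).elim hqd hqr
  have hc : Nat.Coprime q (d * r) := (Nat.Prime.coprime_iff_not_dvd hq).mpr hqdr
  unfold xiZero
  rw [lamTildeZero_prime_pow c' D hq he, if_pos hc,
    innerSum_prime_pow_of_not_dvd_right c' D j hq he hqr,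
    kappaTildeZero_prime_pow_of_coprime c' D j hq he hqd hqr]

end InnerSum

end Literature.NumberTheory.LFunctions.Zhang2022.Lemma83
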